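import Literature.AlgebraicGeometry.Deformation.FirstOrderDeformationKodairaSpencerCocycle
import HarnessLib

/-!
# The Kodaira–Spencer class vanishes iff the local retractions can be chosen compatibly

Layer `Literature/AlgebraicGeometry/Deformation` (cell hodgecm-mathlib, SOCKETS-F §4 (α) node E2-c/d, brick K3b; sequel of
`FirstOrderDeformationKodairaSpencerCocycle`). Same data: `f : X' ⟶ Spec k[ε]` flat with closed fibre `i : X ⟶ X'`, an
affine cover datum `(V, b)` of `X'` with principal pairwise intersections, retractions `σ j` over the `V j`. Hartshorne,
*Deformation Theory*, proof of Thm. 5.3 (p. 39): the class of `(θ_ij)` is trivial iff, after changing the trivialisations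
by a `0`-cochain, the `φ_i` agree on the overlaps («the `X'` is then globally trivial»). Here, at the level of the cover:

* `kodairaSpencerCocycle_eq_zero_of_compatible` — if the restrictions of `σ j` and `σ l` to every `V j ∩ V l` coincide, the
  Kodaira–Spencer cocycle of `σ` is `0`;
* `exists_compatible_retractions_of_kodairaSpencerClass_eq_zero` — conversely, if the Kodaira–Spencer CLASS vanishes in
  `Ȟ¹(i⁻¹𝔙, 𝒯_{X/k})`, there is a retraction system `σ⁽¹⁾` (namely `σ j ⊕ (−α j)` for a `0`-cochain `α` with `θ = d⁰α`)
  whose restrictions to all the `V j ∩ V l` coincide — the local trivialisations glue along the cover.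

Theorems only; no definitions, no named facts. (Gluing the compatible `σ⁽¹⁾ j` to a global retraction `X' → X`, i.e. to a
trivialisation `X' ≅ X × Spec k[ε]`, is scheme-level gluing of morphisms and is not done here.)

## References

* [Hartshorne2010] R. Hartshorne, *Deformation Theory*, GTM 257 (2010): Thm. 5.3 and proof, pp. 38–39.
-/

noncomputable section

-- `TopCat.Presheaf`/`TopCat.Sheaf` are not reducible (as in Mathlib's `AlgebraicGeometry/Modules`).
set_option backward.isDefEq.respectTransparency false

open CategoryTheory AlgebraicGeometry Opposite TopologicalSpace
open TrivSqZeroExt DualNumber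

universe u

namespace Literature.AlgebraicGeometry.Deformation

open Literature.AlgebraicGeometry.HodgeTheory Literature.AlgebraicGeometry.Modules
  Literature.AlgebraicGeometry.Motives Literature.AlgebraicGeometry.Morphisms

variable {k : Type u} [Field k] {X : Over (Spec (CommRingCat.of k))} {X' : Scheme.{u}}
  (f : X' ⟶ Spec (.of k[ε])) {i : X.left ⟶ X'}
  (Hi : IsPullback i X.hom f (Spec.map (CommRingCat.ofHom (fstHom k k k).toRingHom)))
  {ι : Type u} (V : ι → X'.affineOpens) (b : (j l : ι) → Γ(X', (V j).1))
  (hb : ∀ j l, (V j).1 ⊓ (V l).1 = X'.basicOpen (b j l))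
  [Flat f] (σ : (j : ι) → Γ(X.left, i ⁻¹ᵁ (V j).1) →+* Γ(X', (V j).1))
  (hσ : ∀ j a, i.app (V j).1 (σ j a) = a)
  (hσk : ∀ j (s : k), σ j ((constToPresheaf X).app (op (i ⁻¹ᵁ (V j).1)) s) = flatSecStructureMap f (V j).1 (inl s))

include Hi hb hσ in
/-- **Compatible retractions have Kodaira–Spencer cocycle `0`**: if the restrictions of `σ j` and `σ l` to every
`V j ∩ V l` coincide, every cocycle with the characterising property vanishes.
[cite: Hartshorne2010, Thm. 5.3 (proof), pp. 38–39] -/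
theorem kodairaSpencerCocycle_eq_zero_of_compatible
    (hglue : ∀ (j l : ι) (τ τ' : Γ(X.left, i ⁻¹ᵁ ((V j).1 ⊓ (V l).1)) →+* Γ(X', (V j).1 ⊓ (V l).1)),
        (∀ a, X'.presheaf.map (homOfLE inf_le_left).op (σ j a) =
          τ (X.left.presheaf.map (homOfLE (i.preimage_mono inf_le_left)).op a)) →
        (∀ a, X'.presheaf.map (homOfLE inf_le_right).op (σ l a) =
          τ' (X.left.presheaf.map (homOfLE (i.preimage_mono inf_le_right)).op a)) → τ' = τ)
    (θ : CechMC1 X.hom (tangentSheaf X) (fun j => i ⁻¹ᵁ (V j).1))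
    (hθ : ∀ (j l : ι) (τ τ' : Γ(X.left, i ⁻¹ᵁ ((V j).1 ⊓ (V l).1)) →+* Γ(X', (V j).1 ⊓ (V l).1)),
        (∀ a, X'.presheaf.map (homOfLE inf_le_left).op (σ j a) =
          τ (X.left.presheaf.map (homOfLE (i.preimage_mono inf_le_left)).op a)) →
        (∀ a, X'.presheaf.map (homOfLE inf_le_right).op (σ l a) =
          τ' (X.left.presheaf.map (homOfLE (i.preimage_mono inf_le_right)).op a)) →
        ∀ a, τ' a = τ a + sectionOn (flatSmallExtensionParam f (ε : k[ε])) ((V j).1 ⊓ (V l).1) *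
          τ (appLE (θ j l) (𝟙 _) (dSection X (i ⁻¹ᵁ ((V j).1 ⊓ (V l).1)) a) : Γ(X.left, i ⁻¹ᵁ ((V j).1 ⊓ (V l).1)))) :
    θ = 0 := by
  funext j l
  have haff : IsAffineOpen ((V j).1 ⊓ (V l).1) := isAffineOpen_inf V b hb j l
  obtain ⟨τ, hτ⟩ := (existsUnique_retraction_restrict_of_eq_basicOpen f Hi (V j) (b j l) (hb j l)
    (inf_le_left : (V j).1 ⊓ (V l).1 ≤ (V j).1) (σ j) (hσ j)).exists
  obtain ⟨τ', hτ'⟩ := (existsUnique_retraction_restrict_of_eq_basicOpen f Hi (V l) (b l j)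
    (inf_eq_basicOpen_symm V b hb j l) (inf_le_right : (V j).1 ⊓ (V l).1 ≤ (V l).1) (σ l) (hσ l)).exists
  have hτret : ∀ a, i.app _ (τ a) = a := app_eq_self_of_restrict f Hi (V j) (b j l) (hb j l) inf_le_left (hσ j) hτ
  have e := hglue j l τ τ' hτ hτ'
  have h1 := hθ j l τ τ' hτ hτ'
  rw [e] at h1
  rw [Pi.zero_apply, Pi.zero_apply]
  exact tangentSheaf_section_eq_of_eq_add_of_eq_add f Hi ⟨_, haff⟩ hτret h1 (eq_add_zero f ⟨_, haff⟩ τ)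

include Hi hb hσ hσk in
/-- **If the Kodaira–Spencer class vanishes, the local retractions can be re-chosen compatibly**: `[θ] = 0` in
`Ȟ¹(i⁻¹𝔙, 𝒯_{X/k})` gives `θ = d⁰α`, and the retraction system `σ⁽¹⁾ j = σ j ⊕ (−α j)` has cocycle `0`, i.e. its
restrictions to every `V j ∩ V l` coincide («the new `θ'_ij` … then `X'` is trivial»).
[cite: Hartshorne2010, Thm. 5.3 (proof), pp. 38–39] -/
theorem exists_compatible_retractions_of_kodairaSpencerClass_eq_zero
    (θ : CechMC1 X.hom (tangentSheaf X) (fun j => i ⁻¹ᵁ (V j).1))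
    (hθZ : θ ∈ cechMZ1 X.hom (tangentSheaf X) (fun j => i ⁻¹ᵁ (V j).1))
    (hθ : ∀ (j l : ι) (τ τ' : Γ(X.left, i ⁻¹ᵁ ((V j).1 ⊓ (V l).1)) →+* Γ(X', (V j).1 ⊓ (V l).1)),
        (∀ a, X'.presheaf.map (homOfLE inf_le_left).op (σ j a) =
          τ (X.left.presheaf.map (homOfLE (i.preimage_mono inf_le_left)).op a)) →
        (∀ a, X'.presheaf.map (homOfLE inf_le_right).op (σ l a) =
          τ' (X.left.presheaf.map (homOfLE (i.preimage_mono inf_le_right)).op a)) →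
        ∀ a, τ' a = τ a + sectionOn (flatSmallExtensionParam f (ε : k[ε])) ((V j).1 ⊓ (V l).1) *
          τ (appLE (θ j l) (𝟙 _) (dSection X (i ⁻¹ᵁ ((V j).1 ⊓ (V l).1)) a) : Γ(X.left, i ⁻¹ᵁ ((V j).1 ⊓ (V l).1))))
    (h0 : CechMH1.mk X.hom (tangentSheaf X) _ ⟨θ, hθZ⟩ = 0) :
    ∃ σ₁ : (j : ι) → Γ(X.left, i ⁻¹ᵁ (V j).1) →+* Γ(X', (V j).1),
      (∀ j a, i.app (V j).1 (σ₁ j a) = a) ∧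
      (∀ j (s : k), σ₁ j ((constToPresheaf X).app (op (i ⁻¹ᵁ (V j).1)) s) = flatSecStructureMap f (V j).1 (inl s)) ∧
      ∀ (j l : ι) (τ τ' : Γ(X.left, i ⁻¹ᵁ ((V j).1 ⊓ (V l).1)) →+* Γ(X', (V j).1 ⊓ (V l).1)),
        (∀ a, X'.presheaf.map (homOfLE inf_le_left).op (σ₁ j a) =
          τ (X.left.presheaf.map (homOfLE (i.preimage_mono inf_le_left)).op a)) →
        (∀ a, X'.presheaf.map (homOfLE inf_le_right).op (σ₁ l a) =
          τ' (X.left.presheaf.map (homOfLE (i.preimage_mono inf_le_right)).op a)) → τ' = τ := by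
  classical
  -- `θ = d⁰α`
  rw [CechMH1.mk_eq_zero_iff] at h0
  obtain ⟨α, hα⟩ := (mem_cechMB1_iff _ _ _ _).1 h0
  -- the new system `σ₁ j = σ j ⊕ (-α j)`
  have hσ₁ := fun j => (existsUnique_retraction_eq_add f (V j) (σ j) (-α j)).exists
  choose σ₁ hσ₁ using hσ₁
  have hσ₁ret : ∀ j a, i.app (V j).1 (σ₁ j a) = a := fun j => app_eq_self_of_eq_add f Hi (V j) (hσ j) (hσ₁ j)
  have hσ₁k : ∀ j (s : k), σ₁ j ((constToPresheaf X).app (op (i ⁻¹ᵁ (V j).1)) s) =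
      flatSecStructureMap f (V j).1 (inl s) := fun j s =>
    (map_constToPresheaf_eq_of_eq_add f (V j) (hσ₁ j) s).trans (hσk j s)
  -- its cocycle is `θ + d⁰(-α) = 0`
  obtain ⟨θ₁, -, hθ₁⟩ := exists_kodairaSpencerCocycle f Hi V b hb σ₁ hσ₁ret hσ₁k
  have hdiff := kodairaSpencerCocycle_sub_eq_cechMD0 f Hi V b hb σ hσ hσk (-α) σ₁ hσ₁ θ θ₁ hθ hθ₁
  have hθ₁0 : θ₁ = 0 := by
    rw [map_neg, hα, sub_eq_iff_eq_add, neg_add_cancel] at hdiff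
    exact hdiff
  subst hθ₁0
  refine ⟨σ₁, hσ₁ret, hσ₁k, fun j l τ τ' hτ hτ' => ?_⟩
  refine RingHom.ext fun a => ?_
  have e := hθ₁ j l τ τ' hτ hτ' a
  rw [Pi.zero_apply, Pi.zero_apply, appLE_zero] at e
  rw [e]
  change τ a + _ * τ 0 = τ a
  rw [map_zero, mul_zero, add_zero]

end Literature.AlgebraicGeometry.Deformation

end
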